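import Summits.Ventures.CertifiedArithmetic.LowPrec.PatternEnvelopeAddModes
import Literature.ComputerArithmetic.FloatingPoint.Formats

/-!
# Pattern route of Theorem E5, part 6: FP6 sums into WIDE destinations — the `bfloat16` erratum
# cell `1/257` as table theorems without enumeration, and two vanishing contrasts

HONEST FRAMING (venture CertifiedArithmetic / cell `pub-lowprec`): certified error envelopes and
provably optimal rounding/accumulation schemes for low-precision formats under stated cost models;
every table by two implementations; no hardware or vendor claims.

THE `bfloat16` CELL (ENVELOPES.md Table 2 erratum, REFEREE.md Round 10: `E3M2 + E3M2 → bfloat16`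
has maximum relative error `1/257` in RNE / RZ / RU / RD on the normal range, `112` inexact pairs;
confirmed by the referee's own route). Here the three pattern constants
`envconstAddNE/TZ/Dir E3M2 E3M2 BFloat16 = 1/257` are computed by `decide` on the pattern lists of
`PatternEnvelopeAdd.lean` (`16 + 1/16 = 257 · 2^-4` needs `9 > 8` bits; every other aligned sum
fits), and the FOUR table theorems of that row — bound over all `64²` operand pairs on the normal
range of `bfloat16` AND a maximiser, nearest / toward zero / round down / round up — follow from
`MiniFloat.add_rel*_normal_of_envconst` WITHOUT any enumeration of `bfloat16` roundings
(`E3M2_E3M2_add_BFloat16_patternConstantNE/TZ/Dir`, `E3M2_E3M2_add_BFloat16_relNE/RZ/RD/RU_pattern`).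
Contrasts: `E2M3 + E2M3 → BFloat16` and `E3M2 + E3M2 → Binary16` have all three constants `0`
(the pattern-level shadow of `fp6fp4_sums_exact_wide`, `ExactWideFP6FP4.lean`).
FP8 keys are deliberately not instantiated (cell rule: FP8 tables are held).

Placement: venture development under `Summits/Ventures/CertifiedArithmetic/` (operator decision,
BOARD.md); new work of the venture, elementary ([folklore]; format parameters
[cite: OCP-MX-v1.0, §5.3]).
-/

namespace Summit.Ventures.CertifiedArithmetic

open Literature.ComputerArithmetic.FloatingPoint
open Literature.ComputerArithmetic.FloatingPoint.Format
open Literature.ComputerArithmetic.FloatingPoint.MiniFloat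

/-- `E3M2 + E3M2 → BFloat16`, NEAREST pattern constant `1/257` (THEOREMS-R1 Theorem E5; no operand-pair
enumeration); the ENVELOPES.md Table 2 erratum cell: `2^8 + 1` needs `P_R + 1 = 9` bits. [folklore] -/
theorem E3M2_E3M2_add_BFloat16_patternConstantNE : envconstAddNE E3M2 E3M2 BFloat16 = 1 / 257 := by
  decide +kernel

/-- `E3M2 + E3M2 → BFloat16`, TOWARD-ZERO pattern constant `1/257`. [folklore] -/
theorem E3M2_E3M2_add_BFloat16_patternConstantTZ : envconstAddTZ E3M2 E3M2 BFloat16 = 1 / 257 := by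
  decide +kernel

/-- `E3M2 + E3M2 → BFloat16`, DIRECTED (round down = round up) pattern constant `1/257`. [folklore] -/
theorem E3M2_E3M2_add_BFloat16_patternConstantDir : envconstAddDir E3M2 E3M2 BFloat16 = 1 / 257 := by
  decide +kernel

/-- `E3M2 + E3M2 → BFloat16`, NEAREST, by the PATTERN ROUTE: on the normal range `2^-126 ≤ |t| ≤ maxRat`
of `BFloat16` every sum of data satisfies `|RNE(t) - t| ≤ 1/257 · |t|`, and the constant is attained.
[folklore] -/
theorem E3M2_E3M2_add_BFloat16_relNE_pattern :
    (∀ (a : MiniFloat E3M2) (b : MiniFloat E3M2),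
        (2 : ℚ) ^ (-126 : ℤ) ≤ |a.toRat + b.toRat| → |a.toRat + b.toRat| ≤ BFloat16.maxRat →
          |(roundNE BFloat16 (a.toRat + b.toRat)).toRat - (a.toRat + b.toRat)|
            ≤ 1 / 257 * |a.toRat + b.toRat|) ∧
      ∃ (a : MiniFloat E3M2) (b : MiniFloat E3M2),
        (2 : ℚ) ^ (-126 : ℤ) ≤ |a.toRat + b.toRat| ∧ |a.toRat + b.toRat| ≤ BFloat16.maxRat ∧
          |(roundNE BFloat16 (a.toRat + b.toRat)).toRat - (a.toRat + b.toRat)|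
            = 1 / 257 * |a.toRat + b.toRat| :=
  add_relNE_normal_of_envconst BFloat16 (by decide +kernel) E3M2_E3M2_add_BFloat16_patternConstantNE
    (by decide +kernel)

/-- `E3M2 + E3M2 → BFloat16`, TOWARD ZERO, by the PATTERN ROUTE: on the normal range of `BFloat16` every
sum of `E3M2` data satisfies `|RZ(t) - t| ≤ 1/257 · |t|`, attained — the directed cells of the
corrected ENVELOPES.md Table 2 row as a kernel theorem WITHOUT the `64²`-pair enumeration.
[folklore] -/
theorem E3M2_E3M2_add_BFloat16_relRZ_pattern :
    (∀ (a b : MiniFloat E3M2),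
        (2 : ℚ) ^ (-126 : ℤ) ≤ |a.toRat + b.toRat| → |a.toRat + b.toRat| ≤ BFloat16.maxRat →
          |(roundTowardZero BFloat16 (a.toRat + b.toRat)).toRat - (a.toRat + b.toRat)|
            ≤ 1 / 257 * |a.toRat + b.toRat|) ∧
      ∃ (a b : MiniFloat E3M2),
        (2 : ℚ) ^ (-126 : ℤ) ≤ |a.toRat + b.toRat| ∧ |a.toRat + b.toRat| ≤ BFloat16.maxRat ∧
          |(roundTowardZero BFloat16 (a.toRat + b.toRat)).toRat - (a.toRat + b.toRat)|
            = 1 / 257 * |a.toRat + b.toRat| :=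
  add_relTZ_normal_of_envconst BFloat16 (by decide +kernel)
    E3M2_E3M2_add_BFloat16_patternConstantTZ (by decide +kernel)

/-- `E3M2 + E3M2 → BFloat16`, ROUND DOWN, by the PATTERN ROUTE: on the normal range of `BFloat16` every
sum of `E3M2` data satisfies `|RD(t) - t| ≤ 1/257 · |t|`, attained — the directed cells of the
corrected ENVELOPES.md Table 2 row as a kernel theorem WITHOUT the `64²`-pair enumeration.
[folklore] -/
theorem E3M2_E3M2_add_BFloat16_relRD_pattern :
    (∀ (a b : MiniFloat E3M2),
        (2 : ℚ) ^ (-126 : ℤ) ≤ |a.toRat + b.toRat| → |a.toRat + b.toRat| ≤ BFloat16.maxRat →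
          |(roundDown BFloat16 (a.toRat + b.toRat)).toRat - (a.toRat + b.toRat)|
            ≤ 1 / 257 * |a.toRat + b.toRat|) ∧
      ∃ (a b : MiniFloat E3M2),
        (2 : ℚ) ^ (-126 : ℤ) ≤ |a.toRat + b.toRat| ∧ |a.toRat + b.toRat| ≤ BFloat16.maxRat ∧
          |(roundDown BFloat16 (a.toRat + b.toRat)).toRat - (a.toRat + b.toRat)|
            = 1 / 257 * |a.toRat + b.toRat| :=
  add_relRD_normal_of_envconst BFloat16 (by decide +kernel)
    E3M2_E3M2_add_BFloat16_patternConstantDir (by decide +kernel)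

/-- `E3M2 + E3M2 → BFloat16`, ROUND UP, by the PATTERN ROUTE: on the normal range of `BFloat16` every
sum of `E3M2` data satisfies `|RU(t) - t| ≤ 1/257 · |t|`, attained — the directed cells of the
corrected ENVELOPES.md Table 2 row as a kernel theorem WITHOUT the `64²`-pair enumeration.
[folklore] -/
theorem E3M2_E3M2_add_BFloat16_relRU_pattern :
    (∀ (a b : MiniFloat E3M2),
        (2 : ℚ) ^ (-126 : ℤ) ≤ |a.toRat + b.toRat| → |a.toRat + b.toRat| ≤ BFloat16.maxRat →
          |(roundUp BFloat16 (a.toRat + b.toRat)).toRat - (a.toRat + b.toRat)|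
            ≤ 1 / 257 * |a.toRat + b.toRat|) ∧
      ∃ (a b : MiniFloat E3M2),
        (2 : ℚ) ^ (-126 : ℤ) ≤ |a.toRat + b.toRat| ∧ |a.toRat + b.toRat| ≤ BFloat16.maxRat ∧
          |(roundUp BFloat16 (a.toRat + b.toRat)).toRat - (a.toRat + b.toRat)|
            = 1 / 257 * |a.toRat + b.toRat| :=
  add_relRU_normal_of_envconst BFloat16 (by decide +kernel)
    E3M2_E3M2_add_BFloat16_patternConstantDir (by decide +kernel)

set_option maxHeartbeats 1600000 in
/-- `E2M3 + E2M3 → BFloat16`: all three pattern constants vanish (every aligned `E2M3` sum fits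
`8` bits) — contrast with `E3M2 + E3M2 → BFloat16` (heartbeat budget raised: three kernel
evaluations in one declaration). [folklore] -/
theorem E2M3_E2M3_add_BFloat16_patternConstants :
    envconstAddNE E2M3 E2M3 BFloat16 = 0 ∧ envconstAddTZ E2M3 E2M3 BFloat16 = 0 ∧
      envconstAddDir E2M3 E2M3 BFloat16 = 0 := by
  refine ⟨?_, ?_, ?_⟩ <;> decide +kernel

set_option maxHeartbeats 1600000 in
/-- `E3M2 + E3M2 → Binary16`: all three pattern constants vanish (`11` bits hold every aligned
`E3M2` sum), the pattern-level shadow of `sums_exact_in_Binary16` (`ExactWideFP6FP4.lean`;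
heartbeat budget raised: three kernel evaluations in one declaration). [folklore] -/
theorem E3M2_E3M2_add_Binary16_patternConstants :
    envconstAddNE E3M2 E3M2 Binary16 = 0 ∧ envconstAddTZ E3M2 E3M2 Binary16 = 0 ∧
      envconstAddDir E3M2 E3M2 Binary16 = 0 := by
  refine ⟨?_, ?_, ?_⟩ <;> decide +kernel

end Summit.Ventures.CertifiedArithmetic
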